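import Summits.Ventures.MM22.Rank333.ProfileSAT

/-!
# MM22 venture — `ProfileSAT` (2/4): counting, extended literals, direct no-goods

HONEST FRAMING (cell `pub-mm22`, seat engine-2 g3). Plumbing for the verified CNF encoder of `ProfileSATEncode.lean`:
extended literals with Boolean constants and their simplification (`collect`), and the direct no-good block with its
soundness lemma. Nothing here mentions matrices; no rank bound is proved here. Design notes: `ProfileSAT.lean`.
-/

namespace Summit.Ventures.MM22.ProfileSAT

/-! ## 6. Counting, extended literals, direct no-goods -/

/-- Number of listed variables that are true. -/
def cnt (x : ℕ → Bool) (l : List ℕ) : ℕ := l.countP fun v => x v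

/-- The value of a clause depends only on the variables occurring in it. -/
theorem Clause.eval_congr {y y' : ℕ → Bool} {c : Clause} (h : ∀ l ∈ c, y l.var = y' l.var) :
    c.eval y = c.eval y' := by
  unfold Clause.eval
  induction c with
  | nil => rfl
  | cons l c ih =>
    simp only [List.any_cons]
    rw [ih fun l' hl' => h l' (List.mem_cons_of_mem _ hl')]
    congr 1
    have := h l List.mem_cons_self
    cases l <;> simp [Lit.eval, Lit.var] at this ⊢ <;> simp [this]

/-- Extended literal: a literal or a Boolean constant (used to write counter clauses uniformly at the borders). -/
inductive ELit
  /-- constant true -/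
  | tt
  /-- constant false -/
  | ff
  /-- a genuine literal -/
  | lit (l : Lit)

/-- Value of an extended literal. -/
def ELit.eval (y : ℕ → Bool) : ELit → Bool
  | .tt => true
  | .ff => false
  | .lit l => l.eval y

/-- Simplify an extended clause: drop `ff`, and drop the whole clause (`none`) if it contains `tt`. -/
def EClause.toClause : List ELit → Option Clause
  | [] => some []
  | .tt :: _ => none
  | .ff :: r => EClause.toClause r
  | .lit l :: r => (EClause.toClause r).map fun c => l :: c

/-- Collect the simplified clauses of a list of extended clauses. -/
def collect : List (List ELit) → CNF
  | [] => []
  | e :: es =>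
    match EClause.toClause e with
    | none => collect es
    | some c => c :: collect es

/-- A simplified extended clause has the value of the extended clause. -/
theorem EClause.toClause_eval {y : ℕ → Bool} :
    ∀ {e : List ELit} {c : Clause}, EClause.toClause e = some c → c.eval y = e.any (ELit.eval y)
  | [], c, h => by
    simp only [EClause.toClause, Option.some.injEq] at h
    subst h
    rfl
  | .tt :: r, c, h => by simp [EClause.toClause] at h
  | .ff :: r, c, h => by
    simp only [EClause.toClause] at h
    rw [EClause.toClause_eval h]
    simp [ELit.eval]
  | .lit l :: r, c, h => by
    simp only [EClause.toClause] at h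
    cases hr : EClause.toClause r with
    | none => simp [hr] at h
    | some c' =>
      simp only [hr, Option.map_some, Option.some.injEq] at h
      subst h
      have := EClause.toClause_eval (y := y) hr
      simp [Clause.eval, ELit.eval, List.any_cons] at this ⊢
      rw [this]

/-- The literals of a simplified extended clause occur in the extended clause. -/
theorem EClause.toClause_vars :
    ∀ {e : List ELit} {c : Clause}, EClause.toClause e = some c → ∀ l ∈ c, ELit.lit l ∈ e
  | [], c, h, l, hl => by
    simp only [EClause.toClause, Option.some.injEq] at h
    subst h
    simp at hl
  | .tt :: r, c, h, l, hl => by simp [EClause.toClause] at h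
  | .ff :: r, c, h, l, hl => by
    simp only [EClause.toClause] at h
    exact List.mem_cons_of_mem _ (EClause.toClause_vars h l hl)
  | .lit l0 :: r, c, h, l, hl => by
    simp only [EClause.toClause] at h
    cases hr : EClause.toClause r with
    | none => simp [hr] at h
    | some c' =>
      simp only [hr, Option.map_some, Option.some.injEq] at h
      subst h
      rcases List.mem_cons.1 hl with rfl | hl
      · exact List.mem_cons_self
      · exact List.mem_cons_of_mem _ (EClause.toClause_vars hr l hl)

/-- Every collected clause comes from an extended clause. -/
theorem mem_collect {L : List (List ELit)} {c : Clause} (h : c ∈ collect L) :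
    ∃ e ∈ L, EClause.toClause e = some c := by
  induction L with
  | nil => simp [collect] at h
  | cons e es ih =>
    simp only [collect] at h
    cases he : EClause.toClause e with
    | none =>
      rw [he] at h
      obtain ⟨e', he', h'⟩ := ih h
      exact ⟨e', List.mem_cons_of_mem _ he', h'⟩
    | some c' =>
      rw [he] at h
      rcases List.mem_cons.1 h with rfl | h
      · exact ⟨e, List.mem_cons_self, he⟩
      · obtain ⟨e', he', h'⟩ := ih h
        exact ⟨e', List.mem_cons_of_mem _ he', h'⟩

/-- If every extended clause of `L` has a true extended literal under `y`, all collected clauses hold. -/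
theorem collect_sound {y : ℕ → Bool} {L : List (List ELit)} (h : ∀ e ∈ L, e.any (ELit.eval y) = true) :
    ∀ c ∈ collect L, c.eval y = true := by
  intro c hc
  obtain ⟨e, he, hec⟩ := mem_collect hc
  rw [EClause.toClause_eval hec]
  exact h e he

/-- All `(k)`-element sublists of a list, in a fixed order. -/
def combos : ℕ → List ℕ → List (List ℕ)
  | 0, _ => [[]]
  | _ + 1, [] => []
  | k + 1, a :: l => (combos k l).map (fun T => a :: T) ++ combos (k + 1) l

/-- Every list produced by `combos k l` is a sublist of `l` of length `k`. -/
theorem combos_spec : ∀ {k : ℕ} {l T : List ℕ}, T ∈ combos k l → T.Sublist l ∧ T.length = k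
  | 0, l, T, h => by
    simp only [combos, List.mem_singleton] at h
    subst h
    exact ⟨List.nil_sublist _, rfl⟩
  | k + 1, [], T, h => by simp [combos] at h
  | k + 1, a :: l, T, h => by
    simp only [combos, List.mem_append, List.mem_map] at h
    rcases h with ⟨T', hT', rfl⟩ | h
    · obtain ⟨hs, hl⟩ := combos_spec hT'
      exact ⟨hs.cons_cons a, by simp [hl]⟩
    · obtain ⟨hs, hl⟩ := combos_spec h
      exact ⟨hs.cons a, hl⟩

/-- Direct no-goods for «at most `cap` of `members`»: every `(cap+1)`-subset has a false member. -/
def nogoods (members : List ℕ) (cap : ℕ) : CNF :=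
  (combos (cap + 1) members).map fun T => T.map Lit.neg

/-- Direct no-goods hold under any assignment respecting the cap. -/
theorem nogoods_sound {y : ℕ → Bool} {members : List ℕ} {cap : ℕ} (h : cnt y members ≤ cap) :
    ∀ c ∈ nogoods members cap, c.eval y = true := by
  intro c hc
  obtain ⟨T, hT, rfl⟩ := List.mem_map.1 hc
  obtain ⟨hsub, hlen⟩ := combos_spec hT
  by_contra hne
  have hall : ∀ t ∈ T, y t = true := by
    intro t ht
    by_contra hf
    apply hne
    simp only [Clause.eval, List.any_map, List.any_eq_true, Function.comp, Lit.eval]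
    exact ⟨t, ht, by simpa using hf⟩
  have h1 : cnt y T = T.length := List.countP_eq_length.2 (by simpa using hall)
  have h2 : cnt y T ≤ cnt y members := hsub.countP_le
  omega

/-- Direct no-goods mention only member variables. -/
theorem nogoods_vars {members : List ℕ} {cap : ℕ} : ∀ c ∈ nogoods members cap, ∀ l ∈ c, l.var ∈ members := by
  intro c hc l hl
  obtain ⟨T, hT, rfl⟩ := List.mem_map.1 hc
  obtain ⟨t, ht, rfl⟩ := List.mem_map.1 hl
  exact (combos_spec hT).1.subset ht

end Summit.Ventures.MM22.ProfileSAT
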